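import Mathlib
import Summits.PneNP.PneNP.Theorems.Nc03AvoidResidualCoreCandStarReductionChains

/-!
# Route Nc03AvoidResidualCore, item `CandStarReduction` (★) — the tangled-surplus solver, IV: existence

Helper file for `stmt-PneNP-19963` (sequel of `…CandStarReductionChains`; cell pnp-ideate). The
dimension count of the cell memo ROUND-3-ADDENDUM-B Thm B.1 for the root-free solver:

* COVERAGE (`covB_of_mem_tangled`, replaces Lemma B.2): every tangled output of a pure instance has a
  forced data endpoint — its apex `u` is forced unless the other endpoint `w` is a larger apex, and
  then `w` is forced, witnessed by the same output;
* `card_domSet_le` / `card_tangled_le`: parent outputs inject into forced variables, so at least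
  `#tangled − #forced` tangled outputs are SELF-ROOTED;
* `finrank_colSpace_le`: the columns of forced variables vanish, so the column space has dimension
  at most the number of UNFORCED variables;
* `cert_exists`: if every candidate failed, the class indicator of every self-rooted tangled output
  (difference of candidates `t + 1` and `0`, `tgt_succ_add_tgt_zero`) would lie in the column space;
  these indicators are linearly independent (`classVec_apply_root`), so
  `N + 1 − #forced ≤ #tangled − #forced ≤ dim ≤ N − #forced` — contradiction;
* `solStar_correct`: **the ★-solver's output lies outside the range** of every pure `CAND` instance
  with `0 < N` and `N + 1 ≤ #tangled` (existence + `cert_sound`).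

Restricted-model (NC⁰₃) range-avoidance rung F-N1b of the PneNP frontier ladder (an algorithmic reduction between
two restricted AVOID problems); nothing here bears on P vs NP.
-/

set_option linter.dupNamespace false -- `Summit.PneNP.PneNP.…`: summit = sub-problem name (D-0017 single-conjunct layout)

namespace Summit.PneNP.PneNP.Theorems.Nc03CandStarRF

open Finset Literature.Computability.Complexity
open Summit.PneNP.PneNP.Theorems.Nc03Reduction
  (PRaw ETrip enumT inSpan indic searchOut rawOf tripOf mem_enumT_iff mem_enumT rawOf_eq Vec ind bit chi
    vecL vecL_nil inSpan_iff bit_add indic_at searchOut_some)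
open Summit.PneNP.PneNP.Theorems.Nc03AvoidResidualCoreCandCherry (tangled mem_tangled)

variable {N M : ℕ} (J : LocalMap 3 N M)

/-! ## Coverage: every tangled output has a forced data endpoint -/

/-- Nonzero roles are `1` or `2`. -/
theorem role_cases {a : Fin 3} (ha : a ≠ 0) : a = 1 ∨ a = 2 := by
  fin_cases a
  · exact absurd rfl ha
  · exact Or.inl rfl
  · exact Or.inr rfl

/-- A variable read in a nonzero role is a data endpoint. -/
theorem isData_of_role {p : Fin M} {a : Fin 3} (ha : a ≠ 0) {u : Fin N} (h : J.vars p a = u) :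
    isData (tripOf J p) u.val = true := by
  rw [isData_iff']
  rcases role_cases ha with rfl | rfl
  · exact Or.inl h
  · exact Or.inr h

/-- A tangled output is tangled for the program. -/
theorem tangB_of_mem_tangled {p : Fin M} (hp : p ∈ tangled J) : tangB (rawOf J) (eOf J p) = true := by
  obtain ⟨j', hne, hhead, a, b, ha, hb, hab⟩ := mem_tangled.1 hp
  exact tangB_of_shared J hne (congrArg Fin.val hhead) (isData_of_role J ha rfl) (isData_of_role J hb hab.symm)

/-- A witnessed variable is forced. -/
theorem forcedB_of_forceW {u : ℕ} {p : Fin M} (h : forceW (rawOf J) u (eOf J p) = true) :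
    forcedB (rawOf J) u = true := by
  unfold forcedB parOf
  rw [Option.isSome_iff_ne_none]
  intro hnone
  exact (List.find?_eq_none.1 hnone _ (mem_enumT J p)) h

/-- The two data endpoints of a pure output, from one of them. -/
theorem other_datum (hP : J.IsPure candPred) (p : Fin M) {a : Fin 3} (ha : a ≠ 0) :
    ∃ w : Fin N, isData (tripOf J p) w.val = true ∧ w ≠ J.vars p a ∧
      othD (tripOf J p) (J.vars p a).val = w.val ∧ othD (tripOf J p) w.val = (J.vars p a).val := by
  have h12 : J.vars p 1 ≠ J.vars p 2 := fun h => absurd (hP.2 p h) (by decide)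
  have h12' : (J.vars p 1).val ≠ (J.vars p 2).val := fun h => h12 (Fin.ext h)
  rcases role_cases ha with rfl | rfl
  · refine ⟨J.vars p 2, isData_of_role J (a := 2) (by decide) rfl, h12.symm, ?_, ?_⟩
    · simp [othD, tripOf]
    · simp [othD, tripOf, Ne.symm h12']
  · refine ⟨J.vars p 1, isData_of_role J (a := 1) (by decide) rfl, h12, ?_, ?_⟩
    · simp [othD, tripOf, Ne.symm h12']
    · simp [othD, tripOf]

/-- **Coverage.** Every tangled output of a pure instance is covered (has a forced data endpoint):
its apex endpoint `u` is forced unless the other endpoint `w` is a larger apex, and then `w` is forced,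
witnessed by the same output. -/
theorem covB_of_mem_tangled (hP : J.IsPure candPred) {p : Fin M} (hp : p ∈ tangled J) :
    covB (rawOf J) (eOf J p) = true := by
  have ht := tangB_of_mem_tangled J hp
  obtain ⟨j', hne, hhead, a, b, ha, hb, hab⟩ := mem_tangled.1 hp
  have hu : isData (tripOf J p) (J.vars p a).val = true := isData_of_role J ha rfl
  have hu' : isData (tripOf J j') (J.vars p a).val = true := isData_of_role J hb hab.symm
  have hapex : apexB (rawOf J) (J.vars p 0).val (J.vars p a).val = true :=
    (apexB_iff J _ _).2 ⟨p, j', hne.symm, rfl, congrArg Fin.val hhead, hu, hu'⟩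
  obtain ⟨w, hw, hwu, hothu, hothw⟩ := other_datum J hP p ha
  by_cases hrule : w.val < (J.vars p a).val ∨ apexB (rawOf J) (J.vars p 0).val w.val = false
  · have hfw : forceW (rawOf J) (J.vars p a).val (eOf J p) = true :=
      (forceW_iff J).2 ⟨hu, hapex, by rw [show (eOf J p).2 = tripOf J p from rfl, hothu]; exact hrule⟩
    exact covB_of J ht hu (forcedB_of_forceW J hfw)
  · rw [not_or] at hrule
    have hlt : (J.vars p a).val < w.val :=
      lt_of_le_of_ne (not_lt.1 hrule.1) (fun h => hwu (Fin.ext h).symm)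
    have hapexw : apexB (rawOf J) (J.vars p 0).val w.val = true := by
      cases h : apexB (rawOf J) (J.vars p 0).val w.val
      · exact absurd h hrule.2
      · rfl
    have hfw : forceW (rawOf J) w.val (eOf J p) = true :=
      (forceW_iff J).2 ⟨hw, hapexw, Or.inl (by rw [show (eOf J p).2 = tripOf J p from rfl, hothw]; exact hlt)⟩
    exact covB_of J ht hw (forcedB_of_forceW J hfw)

/-! ## Counting forced variables against parent outputs -/

/-- The apex recorded for an output (or `0`). -/
def apexOf (pr : PRaw) (o : ℕ) : ℕ := (((cherries pr).find? fun q => decide (q.2.1.1 = o)).map Prod.fst).getD 0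

/-- The apex of a non-terminal output comes from its cherry. -/
theorem apexOf_spec {o : ℕ} (h : (pNext (rawOf J) o).isSome = true) :
    ∃ q ∈ cherries (rawOf J), q.2.1.1 = o ∧ apexOf (rawOf J) o = q.1 := by
  obtain ⟨o', ho'⟩ := Option.isSome_iff_exists.1 h
  unfold pNext at ho'
  obtain ⟨q, hq, -⟩ := Option.map_eq_some_iff.1 ho'
  have h1 := List.find?_some hq
  refine ⟨q, List.mem_of_find?_eq_some hq, by simpa using h1, ?_⟩
  unfold apexOf; rw [hq]; rfl

/-- The forced variables. -/
def forcedSet : Finset (Fin N) := univ.filter fun v => forcedB (rawOf J) v.val = true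

/-- The non-terminal outputs (parent outputs of cherries). -/
def domSet : Finset (Fin M) := univ.filter fun p => (pNext (rawOf J) p.val).isSome = true

/-- **There are at most as many parent outputs as forced variables.** -/
theorem card_domSet_le (hN : 0 < N) : #(domSet J) ≤ #(forcedSet J) := by
  let φ : Fin M → Fin N := fun p => ⟨min (apexOf (rawOf J) p.val) (N - 1), by omega⟩
  refine Finset.card_le_card_of_injOn φ (fun p hp => ?_) (fun p hp p' hp' h => ?_)
  · obtain ⟨q, hq, -, hap⟩ := apexOf_spec J (Finset.mem_filter.1 hp).2
    obtain ⟨u, hu, hcu⟩ := exists_of_mem_cherries hq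
    have huN : u < N := hu
    obtain ⟨hq1, hpar, -⟩ := cherryOf_eq_some hcu
    rw [forcedSet, Finset.mem_coe, Finset.mem_filter]
    refine ⟨Finset.mem_univ _, ?_⟩
    have hφ : (φ p).val = u := by
      show min (apexOf (rawOf J) p.val) (N - 1) = u
      rw [hap, hq1]; omega
    rw [hφ]
    unfold forcedB; rw [hpar]; rfl
  · obtain ⟨q, hq, hqo, hap⟩ := apexOf_spec J (Finset.mem_filter.1 (Finset.mem_coe.1 hp)).2
    obtain ⟨q', hq', hqo', hap'⟩ := apexOf_spec J (Finset.mem_filter.1 (Finset.mem_coe.1 hp')).2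
    have h1 := fst_lt_of_mem_cherries J hq
    have h1' := fst_lt_of_mem_cherries J hq'
    have hφ : q.1 = q'.1 := by
      have := congrArg Fin.val h
      simp only [φ] at this
      rw [hap, hap'] at this
      omega
    obtain ⟨u, -, hcu⟩ := exists_of_mem_cherries hq
    obtain ⟨u', -, hcu'⟩ := exists_of_mem_cherries hq'
    have hu : q.1 = u := (cherryOf_eq_some hcu).1
    have hu' : q'.1 = u' := (cherryOf_eq_some hcu').1
    rw [← hu, hφ, hu'] at hcu
    rw [hcu] at hcu'
    have hqq : q = q' := Option.some_injective _ hcu'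
    exact Fin.ext (by rw [← hqo, ← hqo', hqq])

/-- The self-rooted tangled outputs. -/
def rootSet : Finset (Fin M) := (tangled J).filter fun p => pNext (rawOf J) p.val = none

/-- **There are at least `#tangled - #forced` self-rooted tangled outputs.** -/
theorem card_tangled_le (hN : 0 < N) : #(tangled J) ≤ #(rootSet J) + #(forcedSet J) := by
  have hsplit := Finset.card_filter_add_card_filter_not (s := tangled J)
    (fun p => pNext (rawOf J) p.val = none)
  have hsub : (tangled J).filter (fun p => ¬ pNext (rawOf J) p.val = none) ⊆ domSet J := by
    intro p hp
    rw [domSet, Finset.mem_filter]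
    exact ⟨Finset.mem_univ _, Option.isSome_iff_ne_none.2 (Finset.mem_filter.1 hp).2⟩
  have := (Finset.card_le_card hsub).trans (card_domSet_le J hN)
  rw [rootSet]
  omega

/-! ## The column space is small -/

/-- Columns vanish at forced variables. -/
theorem colP_of_forced {pr : PRaw} {v : ℕ} (hv : forcedB pr v = true) (t : ℕ × ℕ × ℕ) : colP pr v t = false := by
  have key : ∀ (w : ℕ) (b : Bool), (decide (v = w) && b && !forcedB pr w) = false := by
    intro w b
    by_cases h : v = w
    · subst h; rw [hv]; cases b <;> simp
    · simp [h]
  have key' : ∀ w : ℕ, (decide (v = w) && !forcedB pr w) = false := by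
    intro w
    by_cases h : v = w
    · subst h; rw [hv]; simp
    · simp [h]
  unfold colP
  rw [key', key, key, Bool.false_or, Bool.false_or]

/-- The column of a forced variable is empty. -/
theorem colV_of_forced {pr : PRaw} {v : ℕ} (hv : forcedB pr v = true) : colV pr v = [] := by
  unfold colV
  rw [List.map_eq_nil_iff, List.filter_eq_nil_iff]
  intro e _
  rw [colP_of_forced hv, Bool.and_false]
  exact Bool.false_ne_true

/-- The column space of the certificate. -/
abbrev colSpace : Submodule (ZMod 2) (Vec M) :=
  Submodule.span (ZMod 2) (vecL M '' {r | r ∈ cols (rawOf J)})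

/-- **The column space has dimension at most the number of unforced variables.** -/
theorem finrank_colSpace_le :
    Module.finrank (ZMod 2) (colSpace J) ≤ #(univ.filter fun v : Fin N => ¬ forcedB (rawOf J) v.val = true) := by
  set U := univ.filter fun v : Fin N => ¬ forcedB (rawOf J) v.val = true
  set s : Finset (Vec M) := U.image fun v => vecL M (colV (rawOf J) v.val)
  have hle : colSpace J ≤ Submodule.span (ZMod 2) (↑s : Set (Vec M)) := by
    apply Submodule.span_le.2
    rintro x ⟨r, hr, rfl⟩
    obtain ⟨v, hv, rfl⟩ := List.mem_map.1 hr
    by_cases hf : forcedB (rawOf J) v = true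
    · rw [colV_of_forced hf, vecL_nil]; exact Submodule.zero_mem _
    · apply Submodule.subset_span
      rw [Finset.mem_coe, Finset.mem_image]
      exact ⟨⟨v, List.mem_range.1 hv⟩, Finset.mem_filter.2 ⟨Finset.mem_univ _, hf⟩, rfl⟩
  calc Module.finrank (ZMod 2) (colSpace J)
      ≤ Module.finrank (ZMod 2) (Submodule.span (ZMod 2) (↑s : Set (Vec M))) := Submodule.finrank_mono hle
    _ ≤ s.card := finrank_span_finset_le_card s
    _ ≤ #U := Finset.card_image_le

/-! ## Existence of a certified candidate -/

/-- The class indicator of a self-rooted output `t`: the covered outputs whose root is `t`. -/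
def classVec (t : Fin M) : Vec M := fun p => bit (covB (rawOf J) (eOf J p) && decide ((chain (rawOf J) p.val).1 = t.val))

/-- `xor` bookkeeping: flipping inside a mask. -/
theorem xor_mask (c a d : Bool) : xor (c && xor a d) (c && a) = (c && d) := by
  cases c <;> cases a <;> cases d <;> rfl

/-- **The difference of candidates `t + 1` and `0` is the class indicator of `t`** (for self-rooted `t`). -/
theorem tgt_succ_add_tgt_zero {t : Fin M} (ht : pNext (rawOf J) t.val = none) :
    vecL M (tgt (rawOf J) (t.val + 1)) + vecL M (tgt (rawOf J) 0) = classVec J t := by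
  unfold tgt
  rw [vecL_filter, vecL_filter]
  funext p
  simp only [Pi.add_apply, classVec, bit_add]
  congr 1
  have hroot : (chain (rawOf J) t.val).1 = t.val := by rw [chain_of_none ht]
  have hf1 : flipB (rawOf J) (t.val + 1) p.val = decide ((chain (rawOf J) p.val).1 = t.val) := by
    unfold flipB; rw [Nat.add_sub_cancel, hroot]; simp
  have hf0 : flipB (rawOf J) 0 p.val = false := by unfold flipB; simp
  unfold yB
  rw [show (eOf J p).1 = p.val from rfl, hf1, hf0, Bool.xor_false]
  generalize covB (rawOf J) (eOf J p) = c
  generalize (chain (rawOf J) p.val).2 = a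
  generalize decide ((chain (rawOf J) p.val).1 = t.val) = d
  generalize betaB (rawOf J) (eOf J p).2 = b
  cases c <;> cases a <;> cases d <;> cases b <;> rfl

/-- Reading the class indicator at a self-rooted covered output. -/
theorem classVec_apply_root (hP : J.IsPure candPred) {t t' : Fin M} (ht' : t' ∈ rootSet J) :
    classVec J t t' = if t' = t then 1 else 0 := by
  obtain ⟨htang, hnone⟩ := Finset.mem_filter.1 ht'
  unfold classVec
  rw [covB_of_mem_tangled J hP htang, Bool.true_and, chain_of_none hnone]
  by_cases h : t' = t
  · subst h; simp [bit]
  · have : t'.val ≠ t.val := fun e => h (Fin.ext e)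
    simp [bit, h, this]

/-- **Existence of a certificate** (the dimension count of Thm B.1): some candidate `k ≤ M` is certified. -/
theorem cert_exists (hP : J.IsPure candPred) (hN : 0 < N) (hT : N + 1 ≤ #(tangled J)) :
    ∃ k, k < M + 1 ∧ testC (rawOf J) k = true := by
  have hTM : #(tangled J) ≤ M := (Finset.card_le_univ _).trans (by simp)
  have hNM : N + 1 ≤ M := hT.trans hTM
  by_contra hno
  push Not at hno
  -- every candidate's target is in the column space
  have hin : ∀ k, k < M + 1 → vecL M (tgt (rawOf J) k) ∈ colSpace J := by
    intro k hk
    have h := hno k hk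
    have hM : (rawOf J).2.1 = M := rfl
    unfold testC at h
    rw [consOK_all J hNM k, Bool.true_and, hM] at h
    have h' : inSpan M (cols (rawOf J)) (tgt (rawOf J) k) = true := by
      revert h
      cases inSpan M (cols (rawOf J)) (tgt (rawOf J) k) <;> simp
    exact (inSpan_iff _ _).1 h'
  -- hence every class indicator of a self-rooted tangled output is
  have hcls : ∀ t ∈ rootSet J, classVec J t ∈ colSpace J := by
    intro t ht
    rw [← tgt_succ_add_tgt_zero J (Finset.mem_filter.1 ht).2]
    exact Submodule.add_mem _ (hin _ (by have := t.isLt; omega)) (hin 0 (by omega))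
  -- the class indicators are linearly independent
  have hli : LinearIndependent (ZMod 2) (fun t : ↥(rootSet J) => classVec J (t : Fin M)) := by
    rw [Fintype.linearIndependent_iff]
    intro g hg t₀
    have h := congrFun hg (t₀ : Fin M)
    rw [Finset.sum_apply, Pi.zero_apply] at h
    simp only [Pi.smul_apply, smul_eq_mul] at h
    rw [Finset.sum_eq_single t₀] at h
    · rw [classVec_apply_root J hP t₀.2, if_pos rfl, mul_one] at h
      exact h
    · intro t _ ht
      rw [classVec_apply_root J hP t₀.2, if_neg (fun e => ht (Subtype.ext e).symm), mul_zero]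
    · intro h; exact absurd (Finset.mem_univ _) h
  -- so their number is at most the dimension of the column space
  have hcard : #(rootSet J) ≤ Module.finrank (ZMod 2) (colSpace J) := by
    have h1 := finrank_span_eq_card hli
    have h2 : Submodule.span (ZMod 2) (Set.range fun t : ↥(rootSet J) => classVec J (t : Fin M)) ≤ colSpace J := by
      apply Submodule.span_le.2
      rintro x ⟨t, rfl⟩
      exact hcls t t.2
    have h3 := Submodule.finrank_mono h2
    rw [h1, Fintype.card_coe] at h3
    exact h3
  -- count
  have hU := finrank_colSpace_le J
  have hsplit := Finset.card_filter_add_card_filter_not (s := (univ : Finset (Fin N)))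
    (fun v => forcedB (rawOf J) v.val = true)
  rw [Finset.card_univ, Fintype.card_fin] at hsplit
  have hR := card_tangled_le J hN
  have : #(forcedSet J) = #(univ.filter fun v : Fin N => forcedB (rawOf J) v.val = true) := rfl
  omega

/-! ## The solver is correct -/

/-- Membership in the support list of a candidate. -/
theorem mem_ySet_iff (k : ℕ) (p : Fin M) : p.val ∈ ySet (rawOf J) k ↔ yB (rawOf J) k (eOf J p) = true := by
  unfold ySet
  rw [List.mem_map]
  constructor
  · rintro ⟨e, he, hep⟩
    rw [List.mem_filter] at he
    obtain ⟨p', rfl⟩ := (mem_enumT_iff J).1 he.1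
    have : p' = p := Fin.ext hep
    subst this
    exact he.2
  · intro h
    exact ⟨eOf J p, List.mem_filter.2 ⟨mem_enumT J p, h⟩, rfl⟩

/-- **The ★-solver is correct**: on a pure `CAND` instance with at least `N + 1` tangled outputs its
output pattern lies outside the range. -/
theorem solStar_correct (hP : J.IsPure candPred) (hN : 0 < N) (hT : N + 1 ≤ #(tangled J)) :
    (fun p : Fin M => (solStar (rawOf J)).getD p.val false) ∉ J.range := by
  obtain ⟨k, hk, htest⟩ := cert_exists J hP hN hT
  cases hfind : (List.range (M + 1)).find? (testC (rawOf J)) with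
  | none => exact absurd htest (List.find?_eq_none.1 hfind k (List.mem_range.2 hk))
  | some k' =>
    have ht' := List.find?_some hfind
    unfold testC at ht'
    rw [Bool.and_eq_true, Bool.not_eq_true'] at ht'
    have hsol : solStar (rawOf J) = indic M (ySet (rawOf J) k') := by
      unfold solStar
      rw [show (rawOf J).2.1 = M from rfl, hfind]
      rfl
    have heq : (fun p : Fin M => (solStar (rawOf J)).getD p.val false) = fun p => yB (rawOf J) k' (eOf J p) := by
      funext p
      rw [hsol, indic_at]
      rw [Bool.eq_iff_iff, decide_eq_true_eq, mem_ySet_iff]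
    rw [heq]
    exact cert_sound J hP ht'.1 ht'.2

end Summit.PneNP.PneNP.Theorems.Nc03CandStarRF
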